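import Mathlib
import HarnessLib
import Summits.Langlands.Langlands.Theses.ExteriorSquareAscent
import Literature.NumberTheory.Automorphic.TunnellOctahedralGlobal
import Literature.NumberTheory.Automorphic.TunnellOctahedralGlobalProofs
import Literature.NumberTheory.Automorphic.PairLFunctionPolesRepData
import Literature.NumberTheory.Automorphic.PairLFunctionPolesRepDataHolds
import Literature.NumberTheory.Automorphic.IsobaricRigidityRepData
import Literature.NumberTheory.Automorphic.GaloisActionPlaces
import Literature.NumberTheory.Automorphic.KimExteriorSquareGL4
import Literature.NumberTheory.Automorphic.ArthurClozelCuspidalDescentGLOneHolds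
import Literature.NumberTheory.Automorphic.BaseChangeStrongAllFiniteRamifiedPlaces
import Literature.NumberTheory.GaloisRepresentations.HeckeCharacter
import Summits.Langlands.Langlands.Theorems.ExteriorSquareAscentInducedSquareAscentStubGalConjDatum
import Summits.Langlands.Langlands.Theorems.ExteriorSquareAscentInducedSquareAscentStubUnitaryReduction
import Summits.Langlands.Langlands.Theorems.ExteriorSquareAscentInducedSquareAscentStubLocalIdentities
import Summits.Langlands.Langlands.Theorems.ExteriorSquareAscentInducedSquareAscentStubCentralCharacterDescent
import Summits.Langlands.Langlands.Theorems.ExteriorSquareAscentInducedSquareAscentStubDualityDichotomy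
import Summits.Langlands.Langlands.Theorems.ExteriorSquareAscentInducedSquareAscentStubKleinCubePole

/-!
# Klein-cube skeleton for crux stmt-Langlands-18053
`Summit.Langlands.Langlands.Theses.ExteriorSquareAscent.InducedSquareAscent` — line
`Sketch-klein-cube-pole-transfer` (idea card `Ideas/klein-cube-pole-transfer.md`)

Route `route-Langlands-ExteriorSquareAscent`, rank-2 crux (THE LEVER): `π` cuspidal on `GL₄(𝔸_K)`,
`L/K` quadratic, `P` cuspidal on `GL₃(𝔸_L)`, and at almost every finite `v` of `K` the exterior-square
Satake multiset `∧² t_{π,v}` equals the automorphic-induction multiset of `P` at `v` (split `v`: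
`t_{P,w₁} ⊔ t_{P,w₂}`; non-split `v`: `γ ⊔ (-γ)` with `γ² = t_{P,w}` entrywise). THEN `π` is essentially
self-dual at Satake level (a `GL(1)` datum `η` over `K` with `t_{π,v}⁻¹ = η_v · t_{π,v}` a.e.) OR `π` is
self-twisted by the quadratic sign of some quadratic `L'/K` a.e.

## The line (Klein cube pole transfer: `A₃ = D₃` made automorphic, over `K`, no base change)

Everything is read off PARTIAL RANKIN–SELBERG EULER PRODUCTS of cuspidal Borel–Jacquet data over `K`
and over `L` (Jacquet–Shalika 1981 / Arthur–Clozel Ch. 3 (2.1)–(2.3)), through three Euler-product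
identities that hold prime by prime over `K` once the places of `L` are grouped by the place below
(`w ↦ w ∩ 𝓞_K`): with `ω = ω_π` (`ω(ϖ_v) = e₄(t_{π,v})`), `ω_L = ω ∘ N_{L/K}`, `ε = ε_{L/K}`, `τ` the
non-trivial automorphism of `L/K`, `P^τ` the Galois conjugate (`t_{P^τ,w} = t_{P,τw}`), `ω_P` the
central character of `P`,

* (A)  `L^T(P × P⊗ω_L⁻¹) · L^T(P × P^τ⊗ω_L⁻¹) = L^T(P × P^∨) · L^T(P × P^{τ∨})`
  (both sides are `∏_v L_v(∧²t_π ⊗ ω⁻¹∧²t_π)`, because `(∧²α)⁻¹ = ω⁻¹ ∧²α`);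
* (B') `L^S(π × π^∨) · L^S(π × π^∨⊗ε) = ζ_K^S · L^S(ε) · L^T(P^∨⊗ω_Pω_L⁻¹)² · L^T(P × P^τ⊗ω_L⁻¹)`
  (the plethysm `∧²(∧²α) = ω · Ad⁰α` read on the induced side `∧²(β₁ ⊎ β₂) = ∧²β₁ ⊎ ∧²β₂ ⊎ β₁⊗β₂`,
  `∧²β = e₃(β) β⁻¹`);
* (✦)  `L^S(π × π⊗ωc) · L^S(π^∨ × π^∨⊗ω²c) = L^T(ω_P c_L) · L^T(P^∨ × P^τ⊗ω_P c_L) · L^T(P⊗(ωc)_L)²`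
  for every Hecke character `c` of `K` (the Klein plethysm `∧³(∧²α) = ω·Sym²α ⊎ ω²·Sym²α⁻¹` read on
  `∧³(β₁ ⊎ β₂) = {e₃β₁, e₃β₂} ⊎ ∧²β₁⊗β₂ ⊎ β₁⊗∧²β₂`, and `α⊗α = Sym²α ⊎ ∧²α`).

Pole counting at `s → 1⁺` (each factor `L` has `t^e · L(1+t) → c ≠ 0` with `e ∈ {0,1}` known from
Jacquet–Shalika (2.2)/(2.3)): (B') gives `e(P × P^τ⊗ω_L⁻¹) = e(π × π^∨⊗ε)`, so unless `π` is
`ε_{L/K}`-self-twisted at Satake level (SECOND DISJUNCT, `L' := L`) the pair `(P, P^τ⊗ω_L⁻¹)` has no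
pole, and then (A) forces a pole of `L^T(P × P⊗ω_L⁻¹)`, i.e. `t_{P,w}⁻¹ = ω_L(ϖ_w)⁻¹ t_{P,w}` a.e.
("Case I", `stub_dualityDichotomy`). Case I gives `e₃(t_{P,w₁}) = e₃(t_{P,w₂})` at split places, so
`ω_P` is `Gal(L/K)`-invariant, hence `ω_P = μ ∘ N_{L/K}` (GL(1) descent — a THEOREM of the tree,
`HeckeCharacter.exists_baseChange_eq_of_forall_smul_eq`; `stub_centralCharacterDescent`). With
`c := μ⁻¹` the right side of (✦) is `ζ_L^T(s) · L^T(P^∨ × P^τ) · (…)²` and has a pole, so one of the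
two `GL₄ × GL₄` factors on the left has a pole: `t_{π,v}⁻¹ = χ(ϖ_v) t_{π,v}` a.e. with `χ = ωμ⁻¹` or
`ω⁻²μ` — FIRST DISJUNCT (`stub_kleinCubePole`). The reduction to unitary data (Borel–Jacquet 5.7),
the Galois-conjugate datum `P^τ` (Borel–Jacquet ↔ `L²` dictionary, all discharged in the tree, and
`CuspidalAutomorphicRepGL.galConj`), the regrouping of Euler products along `w ↦ w ∩ 𝓞_K` and the six
local Satake identities are the four service stubs.

LEANS (unproved named facts, hypotheses of the composition): Arthur–Clozel Ch. 3 (2.2) and (2.3) for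
Borel–Jacquet data, `JacquetShalika1981_partialPairL_boundary_repData` and
`JacquetShalika1981_partialPairL_pole_repData` (`PairLFunctionPolesRepData`; (2.1) is the theorem
`JacquetShalika1981_multipliable_partialPairL_repData_holds`). Nothing else: no base change of `π`, no
Kim, no Asgari–Raghuram, no fibre theorem, no class-field existence theorem.

Disproof used: none on file for this crux (`ledger crux ls stmt-Langlands-18053`, 2026-08-17: no
`Disproof.lean`, no `Negative/`).

STATUS 2026-08-17: stubs 1–7 except stub 0 (the two JS named facts) are LANDED theorems of
`Summit.Langlands.Langlands.Theorems.InducedSquareAscentKleinCube` (this file now proves each `stub_*` by the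
landed theorem; the only `sorry` left is `stub_jacquetShalikaLeaves`); the conditional assembly is
`…InducedSquareAscentKleinCube.InducedSquareAscent_of_jacquetShalika` (Theorems/ExteriorSquareAscentInducedSquareAscent.lean).

Shape: stubs `theorem stub_<name> : <signature> := by sorry` over tree declarations only;
`_Goal.stub_<name> : Prop := type_of% @stub_<name>`; the composition
`InducedSquareAscent_of (hJS) (hA) … (hG) : InducedSquareAscent` is proved without `sorry`; the
regrouping of Euler products along `w ↦ w ∩ 𝓞_K` is a lead-side helper lemma (not a stub).
-/

set_option linter.dupNamespace false
set_option linter.unusedVariables false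

noncomputable section

namespace Summit.Langlands.Langlands.Cruxes.InducedSquareAscent.KleinCube

open scoped Classical NumberField
open Filter IsDedekindDomain NumberField
open Summit.Langlands.Langlands.Theses.ExteriorSquareAscent
open Literature.NumberTheory.Automorphic
open Literature.NumberTheory.GaloisRepresentations (HeckeCharacter)

/-! ## 1. The seven stubs (stub 0 = the two leans) -/

/-- **STUB 0 — THE LEANS: Arthur–Clozel Ch. 3 (2.2) and (2.3) for Borel–Jacquet data.** The two
named facts of `PairLFunctionPolesRepData` on which the whole line rests (Jacquet–Shalika 1981 II,
Prop. 3.6 with Shahidi's non-vanishing; (2.1) is the theorem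
`JacquetShalika1981_multipliable_partialPairL_repData_holds`): `L^S(s, π ⊗ σ)` of two cuspidal
Borel–Jacquet data with unitary Satake families extends continuously with NON-ZERO values to
`Re s = 1` off `X`, and has a simple pole with non-zero residue at `s₀ ∈ X`. This stub is NOT a
worker task: it is discharged exactly when the tree discharges the two facts
(`JacquetShalika1981_partialPairL_boundary_repData_of_L2_leaves`,
`JacquetShalika1981_partialPairL_pole_repData_of_pole_of_eq_conj` reduce them to their `L²` leaves);
it is listed so that the composition's hypotheses are exactly the registered stubs (the crux closes
MODULO these two facts). [cite: ArthurClozelAMS120, Ch. 3 §2 (2.2)–(2.3), p. 171]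
[cite: JacquetShalikaAJM1981II, Prop. 3.6] -/
theorem stub_jacquetShalikaLeaves :
    JacquetShalika1981_partialPairL_boundary_repData ∧ JacquetShalika1981_partialPairL_pole_repData := by
  sorry

/-- **STUB 1 — the Galois-conjugate cuspidal datum `P^σ` (Borel–Jacquet model).** For a Galois
automorphism `σ` of `E/F` and a cuspidal Borel–Jacquet datum `P` on `GL_n(𝔸_E)` (`n ≥ 1`) there is a
cuspidal datum `P'` on `GL_n(𝔸_E)` whose Satake parameter at almost every `w` is the Satake parameter
of `P` at `σ • w` (`σ • w` = `instMulActionHeightOneSpectrum` of `GaloisActionPlaces`). Proof line: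
normalise `P` to `Q ≤ L²_cusp` (`CuspidalAutomorphicRepData.exists_satake_eq_cpow_mul_L2_unconditional`,
`t_P = q^{s} t_Q`), take the `L²` Galois conjugate `Q.galConj` (`AutomorphicGaloisConj`,
`HasSatakeParameterAt.galConj`, automorphic measure Galois-invariant by `isGalInvariant_of_unique`),
realise it as a datum (`CuspidalAutomorphicRepGL.exists_cuspidalRepData_eventually_hasSatakeParamAt`)
and twist back by `|det|^{-s}` (`AutomorphicTwistNorm`; `q_{σ w} = q_w`); uniqueness / a.e. existence
of Satake parameters (`hasSatakeParamAt_unique_holds`, `hasSatakeParamAt_cofinite_holds`) give the `↔`.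
Pattern: `cuspidal_descent_cyclic_of_clean_leaves` (`CuspidalDescentCyclicRepData`) with "descend"
replaced by "conjugate". Size M. [cite: ArthurClozelAMS120, Ch. 3 §1 (the conjugate `Π^σ`)]
[cite: BorelJacquetCorvallis1979, 4.6 and 5.7] -/
theorem stub_galConjDatum :
    ∀ (n : ℕ) [NeZero n] (F E : Type) [Field F] [NumberField F] [Field E] [NumberField E]
      [Algebra F E] (hE : isCompact_glFiniteIntegralLevel n E) (σ : E ≃ₐ[F] E)
      (P : CuspidalAutomorphicRepData n E hE),
      ∃ P' : CuspidalAutomorphicRepData n E hE,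
        ∀ᶠ w : HeightOneSpectrum (𝓞 E) in cofinite, ∀ β : Multiset ℂ,
          P'.1.HasSatakeParamAt w β ↔ P.1.HasSatakeParamAt (σ • w) β :=
  Summit.Langlands.Langlands.Theorems.InducedSquareAscentKleinCube.stub_galConjDatum

/-- **STUB 2 — reduction to unitary data (Borel–Jacquet 5.7) and transport of the two disjuncts.**
Given the crux data `π, L, P` with the matching hypothesis, there are cuspidal data `π₀` on
`GL₄(𝔸_K)` and `P₀` on `GL₃(𝔸_L)` with UNITARY, ZERO-FREE Satake parameters a.e.
(`‖∏ t‖ = 1`), satisfying the SAME matching hypothesis, and such that essential self-duality of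
`π₀` by a Hecke character (resp. the `ε_{L/K}`-self-twist of `π₀`) at Satake level a.e. implies the
crux's first disjunct for `π` (resp. the `ε_{L/K}`-self-twist of `π`). Proof line:
`CuspidalAutomorphicRepData.exists_unitary_avatar` gives `π₀ = π ⊗ |det|^{-s}` with
`t_{π,v} = q_v^{s} t_{π₀,v}` exactly off a finite set; put `P₀ = P ⊗ |det|_L^{-2s}`
(`exists_cuspidalAutomorphicRepData_map_mulChar_detTwist` with `exists_heckeCharacter_ideleNorm_cpow`,
Satake parameters `q_w^{-2s} t_{P,w}` by `HasSatakeParamAt.of_map_mulChar_detTwist_of_cpow`); the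
matching hypothesis transports because `∧²(c α) = c² ∧²α` (`wedgeTwoParams_map_mul`) and
`q_{w} = q_v^{f(w|v)}`; `P₀` is unitary a.e. because `exists_unitary_avatar` for `P₀` gives
`‖e₃ t_{P₀,w}‖ = q_w^{3 re s'}` and the matching at ONE good place forces `re s' = 0`
(`e₆(∧²α) = e₄(α)³`, `prod_wedgeTwoParams`); the transports back: `t_{π₀}⁻¹ = χ t_{π₀}` gives
`t_π⁻¹ = (q_v^{-2s} χ(ϖ_v)) t_π`, realised by the `GL(1)` datum of `χ · ‖·‖^{2s}`
(`GLOneOfHeckeCharacterBJ` / `AutomorphicRepsGLOneHeckeCharacter`), and the self-twist identity is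
homogeneous. Size M. [cite: BorelJacquetCorvallis1979, 5.7] -/
theorem stub_unitaryReduction :
    ∀ (K : Type) [Field K] [NumberField K] (h1 : isCompact_glFiniteIntegralLevel 1 K)
      (hcpt : isCompact_glFiniteIntegralLevel 4 K) (π : CuspidalAutomorphicRepData 4 K hcpt)
      (L : Type) [Field L] [NumberField L] [Algebra K L], Module.finrank K L = 2 →
      ∀ (hL3 : isCompact_glFiniteIntegralLevel 3 L) (P : CuspidalAutomorphicRepData 3 L hL3),
      (∀ᶠ v : HeightOneSpectrum (𝓞 K) in cofinite, ∀ α : Multiset ℂ, π.1.HasSatakeParamAt v α →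
        ((∃ w : HeightOneSpectrum (𝓞 L), w.asIdeal.under (𝓞 K) = v.asIdeal ∧
            w.asIdeal.inertiaDeg (𝓞 K) = 1) →
          ∃ w₁ w₂ : HeightOneSpectrum (𝓞 L), w₁ ≠ w₂ ∧ w₁.asIdeal.under (𝓞 K) = v.asIdeal ∧
            w₂.asIdeal.under (𝓞 K) = v.asIdeal ∧ ∃ β₁ β₂ : Multiset ℂ, P.1.HasSatakeParamAt w₁ β₁ ∧
              P.1.HasSatakeParamAt w₂ β₂ ∧ (α.powersetCard 2).map Multiset.prod = β₁ + β₂) ∧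
        ((¬ ∃ w : HeightOneSpectrum (𝓞 L), w.asIdeal.under (𝓞 K) = v.asIdeal ∧
            w.asIdeal.inertiaDeg (𝓞 K) = 1) →
          ∃ w : HeightOneSpectrum (𝓞 L), w.asIdeal.under (𝓞 K) = v.asIdeal ∧
            ∃ β γ : Multiset ℂ, P.1.HasSatakeParamAt w β ∧ γ.map (fun c => c ^ 2) = β ∧
              (α.powersetCard 2).map Multiset.prod = γ + γ.map (fun c => -c))) →
      ∃ (π₀ : CuspidalAutomorphicRepData 4 K hcpt) (P₀ : CuspidalAutomorphicRepData 3 L hL3),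
        (∀ᶠ v : HeightOneSpectrum (𝓞 K) in cofinite, ∀ α : Multiset ℂ, π₀.1.HasSatakeParamAt v α →
          ‖α.prod‖ = 1 ∧ ∀ a ∈ α, a ≠ 0) ∧
        (∀ᶠ w : HeightOneSpectrum (𝓞 L) in cofinite, ∀ β : Multiset ℂ, P₀.1.HasSatakeParamAt w β →
          ‖β.prod‖ = 1 ∧ ∀ b ∈ β, b ≠ 0) ∧
        (∀ᶠ v : HeightOneSpectrum (𝓞 K) in cofinite, ∀ α : Multiset ℂ, π₀.1.HasSatakeParamAt v α →
          ((∃ w : HeightOneSpectrum (𝓞 L), w.asIdeal.under (𝓞 K) = v.asIdeal ∧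
              w.asIdeal.inertiaDeg (𝓞 K) = 1) →
            ∃ w₁ w₂ : HeightOneSpectrum (𝓞 L), w₁ ≠ w₂ ∧ w₁.asIdeal.under (𝓞 K) = v.asIdeal ∧
              w₂.asIdeal.under (𝓞 K) = v.asIdeal ∧ ∃ β₁ β₂ : Multiset ℂ,
                P₀.1.HasSatakeParamAt w₁ β₁ ∧ P₀.1.HasSatakeParamAt w₂ β₂ ∧
                  (α.powersetCard 2).map Multiset.prod = β₁ + β₂) ∧
          ((¬ ∃ w : HeightOneSpectrum (𝓞 L), w.asIdeal.under (𝓞 K) = v.asIdeal ∧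
              w.asIdeal.inertiaDeg (𝓞 K) = 1) →
            ∃ w : HeightOneSpectrum (𝓞 L), w.asIdeal.under (𝓞 K) = v.asIdeal ∧
              ∃ β γ : Multiset ℂ, P₀.1.HasSatakeParamAt w β ∧ γ.map (fun c => c ^ 2) = β ∧
                (α.powersetCard 2).map Multiset.prod = γ + γ.map (fun c => -c))) ∧
        ((∃ χ : HeckeCharacter K, ∀ᶠ v : HeightOneSpectrum (𝓞 K) in cofinite, ∀ α : Multiset ℂ,
            π₀.1.HasSatakeParamAt v α →
              α.map (fun a => a⁻¹) = α.map (fun a => χ.valueAtUniformizer v * a)) →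
          ∃ η : CuspidalAutomorphicRepData 1 K h1, ∀ᶠ v in cofinite, ∀ α : Multiset ℂ,
            π.1.HasSatakeParamAt v α →
              ∃ e : ℂ, η.1.HasSatakeParamAt v {e} ∧ α.map (fun a => a⁻¹) = α.map (fun a => e * a)) ∧
        ((∀ᶠ v : HeightOneSpectrum (𝓞 K) in cofinite, ∀ α : Multiset ℂ, π₀.1.HasSatakeParamAt v α →
            α.map (fun a => quadraticSign L v * a) = α) →
          ∀ᶠ v : HeightOneSpectrum (𝓞 K) in cofinite, ∀ α : Multiset ℂ, π.1.HasSatakeParamAt v α →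
            α.map (fun a => quadraticSign L v * a) = α) :=
  Summit.Langlands.Langlands.Theorems.InducedSquareAscentKleinCube.stub_unitaryReduction

/-- **STUB 3 — the six local Satake identities (pure algebra of multisets / Euler factors).**
Notation: `SP a b y = (satakePairPolynomial a b).eval y = ∏_{p ∈ a, q ∈ b} (1 - p q y)` (the
reciprocal Rankin–Selberg Euler factor), `ω = ∏ α = e₄(α)`, `∧²α = wedgeTwoParams α`.
SPLIT data: `card α = 4`, `0 ∉ α`, `card βᵢ = 3`, `∧²α = β₁ + β₂`. NON-SPLIT data: `card α = 4`,
`0 ∉ α`, `card γ = 3`, `∧²α = γ + (-γ)`, `β = γ²` (entrywise), local variable `y = x²` on the `L`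
side (`q_w = q_v²`), `ω_L(ϖ_w) = ω²`, `c_L(ϖ_w) = c²`, `t_{P^τ,w} = β`.
(1) split (B'): `SP(α,α⁻¹)² = SP({1},{1})² · (SP(e₃β₁ω⁻¹·β₁⁻¹,{1}) SP(e₃β₂ω⁻¹·β₂⁻¹,{1}))² ·
    SP(β₁,ω⁻¹β₂) SP(β₂,ω⁻¹β₁)` — from `α⊗α⁻¹ = {1} ⊎ ω⁻¹∧²(∧²α)` (GL₄: `∧²∘∧² = Ad⁰ ⊗ det`) and
    `∧²(β₁⊎β₂) = ∧²β₁ ⊎ ∧²β₂ ⊎ β₁⊗β₂`, `∧²β = e₃(β)β⁻¹`;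
(2) non-split (B'): `SP(α,α⁻¹) SP(α,-α⁻¹) = SP({1},{1}) SP({1},{-1}) SP_y(e₃βω⁻²·β⁻¹,{1})² SP_y(β,ω⁻²β)`;
(3) split (A): `SP(β₁,ω⁻¹β₁)SP(β₂,ω⁻¹β₂)·(SP(β₁,ω⁻¹β₂)SP(β₂,ω⁻¹β₁)) =
    SP(β₁,β₁⁻¹)SP(β₂,β₂⁻¹)·(SP(β₁,β₂⁻¹)SP(β₂,β₁⁻¹))` — from `(∧²α)⁻¹ = ω⁻¹∧²α`;
(4) non-split duality: `β⁻¹ = ω⁻²β` (same source, squared);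
(5) split (✦): `SP(α,ωc·α) SP(α⁻¹,ω²c·α⁻¹) = (SP({e₃β₁c},{1})SP({e₃β₂c},{1})) ·
    (SP(β₁⁻¹,e₃β₁c·β₂) SP(β₂⁻¹,e₃β₂c·β₁)) · (SP(ωc·β₁,{1}) SP(ωc·β₂,{1}))²` — from the Klein
    plethysm `∧³(∧²α) = ω·Sym²α ⊎ ω²·Sym²α⁻¹`, `α⊗α = Sym²α ⊎ ∧²α` and
    `∧³(β₁⊎β₂) = {e₃β₁,e₃β₂} ⊎ ∧²β₁⊗β₂ ⊎ β₁⊗∧²β₂`;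
(6) non-split (✦): `SP(α,ωc·α) SP(α⁻¹,ω²c·α⁻¹) = SP_y({e₃β c²},{1}) SP_y(β⁻¹,e₃βc²·β) SP_y(ω²c²·β,{1})²`.
All six were verified numerically on random points of the constraint variety (lead's
`scratch/check_LI.py`, 40 trials, 2026-08-17). Tree tools: `wedgeTwoParams_four`-style expansions,
`satakePairPolynomial_eq_eulerPolynomial`, `eval_eulerPolynomial`, `satakeTensor_cons_left`,
`Multiset.card_eq_three`. Size L (mechanical). [folklore]
[cite: FultonHarrisRepTheory1991, §15.2 and §19.1 (`A₃ = D₃`, `∧²ℂ⁴` as the vector representation of `SO₆`)] -/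
theorem stub_localIdentities :
    (∀ (x : ℂ) (α β₁ β₂ : Multiset ℂ), Multiset.card α = 4 → (∀ a ∈ α, a ≠ 0) →
        Multiset.card β₁ = 3 → Multiset.card β₂ = 3 → wedgeTwoParams α = β₁ + β₂ →
        ((satakePairPolynomial α (α.map (fun a => a⁻¹))).eval x) ^ 2 =
          ((satakePairPolynomial ({1} : Multiset ℂ) ({1} : Multiset ℂ)).eval x) ^ 2 *
          (((satakePairPolynomial ((β₁.map (fun b => b⁻¹)).map (fun b => (β₁.prod * (α.prod)⁻¹) * b))
                ({1} : Multiset ℂ)).eval x) *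
            ((satakePairPolynomial ((β₂.map (fun b => b⁻¹)).map (fun b => (β₂.prod * (α.prod)⁻¹) * b))
                ({1} : Multiset ℂ)).eval x)) ^ 2 *
          (((satakePairPolynomial β₁ (β₂.map (fun b => (α.prod)⁻¹ * b))).eval x) *
            ((satakePairPolynomial β₂ (β₁.map (fun b => (α.prod)⁻¹ * b))).eval x))) ∧
    (∀ (x : ℂ) (α γ : Multiset ℂ), Multiset.card α = 4 → (∀ a ∈ α, a ≠ 0) →
        Multiset.card γ = 3 → wedgeTwoParams α = γ + γ.map (fun c => -c) →
        ((satakePairPolynomial α (α.map (fun a => a⁻¹))).eval x) *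
          ((satakePairPolynomial α ((α.map (fun a => a⁻¹)).map (fun a => (-1 : ℂ) * a))).eval x) =
          ((satakePairPolynomial ({1} : Multiset ℂ) ({1} : Multiset ℂ)).eval x) *
          ((satakePairPolynomial ({1} : Multiset ℂ) ({-1} : Multiset ℂ)).eval x) *
          ((satakePairPolynomial
              (((γ.map (fun c => c ^ 2)).map (fun b => b⁻¹)).map
                (fun b => ((γ.map (fun c => c ^ 2)).prod * ((α.prod) ^ 2)⁻¹) * b))
              ({1} : Multiset ℂ)).eval (x ^ 2)) ^ 2 *
          ((satakePairPolynomial (γ.map (fun c => c ^ 2))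
              ((γ.map (fun c => c ^ 2)).map (fun b => ((α.prod) ^ 2)⁻¹ * b))).eval (x ^ 2))) ∧
    (∀ (x : ℂ) (α β₁ β₂ : Multiset ℂ), Multiset.card α = 4 → (∀ a ∈ α, a ≠ 0) →
        Multiset.card β₁ = 3 → Multiset.card β₂ = 3 → wedgeTwoParams α = β₁ + β₂ →
        ((satakePairPolynomial β₁ (β₁.map (fun b => (α.prod)⁻¹ * b))).eval x) *
          ((satakePairPolynomial β₂ (β₂.map (fun b => (α.prod)⁻¹ * b))).eval x) *
          (((satakePairPolynomial β₁ (β₂.map (fun b => (α.prod)⁻¹ * b))).eval x) *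
            ((satakePairPolynomial β₂ (β₁.map (fun b => (α.prod)⁻¹ * b))).eval x)) =
        ((satakePairPolynomial β₁ (β₁.map (fun b => b⁻¹))).eval x) *
          ((satakePairPolynomial β₂ (β₂.map (fun b => b⁻¹))).eval x) *
          (((satakePairPolynomial β₁ (β₂.map (fun b => b⁻¹))).eval x) *
            ((satakePairPolynomial β₂ (β₁.map (fun b => b⁻¹))).eval x))) ∧
    (∀ (α γ : Multiset ℂ), Multiset.card α = 4 → (∀ a ∈ α, a ≠ 0) →
        Multiset.card γ = 3 → wedgeTwoParams α = γ + γ.map (fun c => -c) →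
        (γ.map (fun c => c ^ 2)).map (fun b => b⁻¹) =
          (γ.map (fun c => c ^ 2)).map (fun b => ((α.prod) ^ 2)⁻¹ * b)) ∧
    (∀ (x c : ℂ) (α β₁ β₂ : Multiset ℂ), Multiset.card α = 4 → (∀ a ∈ α, a ≠ 0) →
        Multiset.card β₁ = 3 → Multiset.card β₂ = 3 → wedgeTwoParams α = β₁ + β₂ →
        ((satakePairPolynomial α (α.map (fun a => (α.prod * c) * a))).eval x) *
          ((satakePairPolynomial (α.map (fun a => a⁻¹))
              ((α.map (fun a => a⁻¹)).map (fun a => (α.prod ^ 2 * c) * a))).eval x) =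
          (((satakePairPolynomial ({β₁.prod * c} : Multiset ℂ) ({1} : Multiset ℂ)).eval x) *
            ((satakePairPolynomial ({β₂.prod * c} : Multiset ℂ) ({1} : Multiset ℂ)).eval x)) *
          (((satakePairPolynomial (β₁.map (fun b => b⁻¹)) (β₂.map (fun b => (β₁.prod * c) * b))).eval x) *
            ((satakePairPolynomial (β₂.map (fun b => b⁻¹)) (β₁.map (fun b => (β₂.prod * c) * b))).eval x)) *
          (((satakePairPolynomial (β₁.map (fun b => (α.prod * c) * b)) ({1} : Multiset ℂ)).eval x) *
            ((satakePairPolynomial (β₂.map (fun b => (α.prod * c) * b)) ({1} : Multiset ℂ)).eval x)) ^ 2) ∧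
    (∀ (x c : ℂ) (α γ : Multiset ℂ), Multiset.card α = 4 → (∀ a ∈ α, a ≠ 0) →
        Multiset.card γ = 3 → wedgeTwoParams α = γ + γ.map (fun c => -c) →
        ((satakePairPolynomial α (α.map (fun a => (α.prod * c) * a))).eval x) *
          ((satakePairPolynomial (α.map (fun a => a⁻¹))
              ((α.map (fun a => a⁻¹)).map (fun a => (α.prod ^ 2 * c) * a))).eval x) =
          ((satakePairPolynomial ({(γ.map (fun c => c ^ 2)).prod * c ^ 2} : Multiset ℂ)
              ({1} : Multiset ℂ)).eval (x ^ 2)) *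
          ((satakePairPolynomial ((γ.map (fun c => c ^ 2)).map (fun b => b⁻¹))
              ((γ.map (fun c => c ^ 2)).map (fun b => ((γ.map (fun c => c ^ 2)).prod * c ^ 2) * b))).eval
              (x ^ 2)) *
          ((satakePairPolynomial ((γ.map (fun c => c ^ 2)).map (fun b => (α.prod ^ 2 * c ^ 2) * b))
              ({1} : Multiset ℂ)).eval (x ^ 2)) ^ 2) :=
  Summit.Langlands.Langlands.Theorems.InducedSquareAscentKleinCube.stub_localIdentities

/-- **STUB 5 — the central character of `P` descends (Step C of the card: `ω_P = μ ∘ N_{L/K}`).**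
Let `L/K` be Galois quadratic, `τ ≠ 1`, `π₀` cuspidal on `GL₄(𝔸_K)` with zero-free Satake parameters
a.e., `P₀` cuspidal on `GL₃(𝔸_L)` with zero-free Satake parameters a.e., matching as in the crux,
and assume CASE I: `t_{P₀,w}⁻¹ = ω(ϖ_v)^{-f(w|v)} t_{P₀,w}` at almost every `w` (`ω(ϖ_v) = e₄(t_{π₀,v})`,
`v = w ∩ 𝓞_K`). Then there is a Hecke character `μ` of `K` with `e₃(t_{P₀,w}) = μ(ϖ_v)^{f(w|v)}` for
almost all `w`. Proof line: at a split `v` with places `w₁ ≠ w₂ = τ • w₁`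
(`HeightOneSpectrum.exists_algEquiv_smul_eq`, `card_placesOver_mul_inertiaDegIn`), `e₃(β₁) e₃(β₂) = e₆(∧²α) = ω³` (`prod_wedgeTwoParams`) and Case I at `w₁` gives
`e₃(β₁)⁻¹ = ω⁻³ e₃(β₁)`, so `e₃(β₁)² = ω³` and `e₃(β₂) = e₃(β₁)`; at a non-split `w`, `τ • w = w`.
Hence the central character `ω_P` of `P₀` (`exists_heckeCharacter_prod_satake'`:
`ω_P(ϖ_w) = e₃(t_{P₀,w})` a.e.) and its Galois conjugate (`HeckeCharacter.exists_galConj`,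
`HeckeCharacter.valueAtUniformizer_galConj`) agree at almost every uniformizer, so coincide
(`HeckeCharacter.ext_of_eventually_valueAtUniformizer_eq`, `StrongMultiplicityOneGLOne`), i.e. `ω_P`
is `Gal(L/K)`-invariant; by GL(1) descent (`HeckeCharacter.exists_baseChange_eq_of_forall_smul_eq`,
a THEOREM: `[L:K] = 2` prime) `ω_P = μ.baseChange L`, whose value at `ϖ_w` is `μ(ϖ_v)^{f(w|v)}` a.e.
(`HeckeCharacter.eventually_valueAtUniformizer_baseChange`). Size M.
[cite: ArthurClozelAMS120, Ch. 3, Thm. 4.2 (d) for n = 1] [cite: CasselsFrohlichANT1967, Ch. VII §9 Thm. 9.1] -/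
theorem stub_centralCharacterDescent :
    ∀ (K L : Type) [Field K] [NumberField K] [Field L] [NumberField L] [Algebra K L] [IsGalois K L],
      Module.finrank K L = 2 → ∀ (τ : L ≃ₐ[K] L), τ ≠ 1 →
      ∀ (hcpt : isCompact_glFiniteIntegralLevel 4 K) (hL3 : isCompact_glFiniteIntegralLevel 3 L)
        (π₀ : CuspidalAutomorphicRepData 4 K hcpt) (P₀ : CuspidalAutomorphicRepData 3 L hL3),
      (∀ᶠ v : HeightOneSpectrum (𝓞 K) in cofinite, ∀ α : Multiset ℂ, π₀.1.HasSatakeParamAt v α →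
        ∀ a ∈ α, a ≠ 0) →
      (∀ᶠ w : HeightOneSpectrum (𝓞 L) in cofinite, ∀ β : Multiset ℂ, P₀.1.HasSatakeParamAt w β →
        ∀ b ∈ β, b ≠ 0) →
      (∀ᶠ v : HeightOneSpectrum (𝓞 K) in cofinite, ∀ α : Multiset ℂ, π₀.1.HasSatakeParamAt v α →
        ((∃ w : HeightOneSpectrum (𝓞 L), w.asIdeal.under (𝓞 K) = v.asIdeal ∧
            w.asIdeal.inertiaDeg (𝓞 K) = 1) →
          ∃ w₁ w₂ : HeightOneSpectrum (𝓞 L), w₁ ≠ w₂ ∧ w₁.asIdeal.under (𝓞 K) = v.asIdeal ∧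
            w₂.asIdeal.under (𝓞 K) = v.asIdeal ∧ ∃ β₁ β₂ : Multiset ℂ,
              P₀.1.HasSatakeParamAt w₁ β₁ ∧ P₀.1.HasSatakeParamAt w₂ β₂ ∧
                (α.powersetCard 2).map Multiset.prod = β₁ + β₂) ∧
        ((¬ ∃ w : HeightOneSpectrum (𝓞 L), w.asIdeal.under (𝓞 K) = v.asIdeal ∧
            w.asIdeal.inertiaDeg (𝓞 K) = 1) →
          ∃ w : HeightOneSpectrum (𝓞 L), w.asIdeal.under (𝓞 K) = v.asIdeal ∧
            ∃ β γ : Multiset ℂ, P₀.1.HasSatakeParamAt w β ∧ γ.map (fun c => c ^ 2) = β ∧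
              (α.powersetCard 2).map Multiset.prod = γ + γ.map (fun c => -c))) →
      (∀ᶠ w : HeightOneSpectrum (𝓞 L) in cofinite, ∀ α β : Multiset ℂ,
        π₀.1.HasSatakeParamAt (w.under (𝓞 K)) α → P₀.1.HasSatakeParamAt w β →
          β.map (fun b => b⁻¹) = β.map (fun b => (α.prod ^ w.asIdeal.inertiaDeg (𝓞 K))⁻¹ * b)) →
      ∃ μ : HeckeCharacter K, ∀ᶠ w : HeightOneSpectrum (𝓞 L) in cofinite, ∀ β : Multiset ℂ,
        P₀.1.HasSatakeParamAt w β →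
          β.prod = μ.valueAtUniformizer (w.under (𝓞 K)) ^ w.asIdeal.inertiaDeg (𝓞 K) :=
  Summit.Langlands.Langlands.Theorems.InducedSquareAscentKleinCube.stub_centralCharacterDescent

/-- **STUB 6 — the duality dichotomy (Steps A+B of the card: (A) + (B') + Jacquet–Shalika).**
For unitary zero-free matching data `(π₀, P₀)`, a Galois-conjugate datum `P₀^τ`, and granted
Arthur–Clozel Ch. 3 (2.2), (2.3) for Borel–Jacquet data: EITHER `π₀` is `ε_{L/K}`-self-twisted at
Satake level a.e. (`ε(v) t = t`, `ε = quadraticSign`), OR (Case I) `t_{P₀,w}⁻¹ = ω(ϖ_v)^{-f(w|v)} t_{P₀,w}`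
at almost every `w`. Proof line: by_cases on the first disjunct; if it fails, Jacquet–Shalika (2.2)
applies to `(π₀, π₀^∨ ⊗ ε)` (its set `X` is exactly the failed disjunct), so in identity (B')
— `L^S(π₀×π₀^∨)·L^S(π₀×π₀^∨⊗ε) = ζ_K^S·L^S(ε)·L^T(P₀^∨⊗ω_Pω_L⁻¹)²·L^T(P₀×P₀^τ⊗ω_L⁻¹)`, valid for
real `s > 1` by `stub_localIdentities` (1)(2) regrouped along `w ↦ w ∩ 𝓞_K` (lead helper `regroup_quadratic`) over `S ⊇`
{ramified places} ∪ {exceptional places of all a.e. statements} ∪ {the `S₀`'s of the JS facts} —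
the left side has `t·LHS(1+t) → c ≠ 0` ((2.3) for `(π₀,π₀^∨)`, (2.2) for the other factor) while
`ζ_K`, `L(ε)` (`ε ≠ 1` a.e. fails: the class-field character has order 2, so infinitely many inert
places — `exists_heckeCharacter_quadraticSign_of_finrank_eq_two`, Hecke rigidity), the `GL₃×GL₁`
factor ((2.2), ranks differ) contribute `t^{1+0+0}`, whence the pair `(P₀, P₀^τ⊗ω_L⁻¹)` is NOT in
`X` (else (2.3) would give `t²·RHS → c' ≠ 0` against `t²·LHS → 0`), i.e. ¬Case II; then identity (A)
— `L^T(P₀×P₀⊗ω_L⁻¹)·L^T(P₀×P₀^τ⊗ω_L⁻¹) = L^T(P₀×P₀^∨)·L^T(P₀×P₀^{τ∨})` (`stub_localIdentities`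
(3)(4)) — has a right side with `t^{1+e}·RHS → c ≠ 0`, so `L^T(P₀×P₀⊗ω_L⁻¹)` cannot stay bounded:
its pair is in `X`, which is Case I. Data: central character `ω` (`exists_heckeCharacter_prod_satake'`)
and its base change (`HeckeCharacter.baseChange`, `eventually_valueAtUniformizer_baseChange`), `ε` as a
Hecke character (`exists_heckeCharacter_quadraticSign_of_finrank_eq_two`), contragredients
(`exists_contragredient_satake_holds`), twists by Hecke characters (`CuspidalAutomorphicRepData.twist`,
`eventually_hasSatakeParamAt_twist`), `GL(1)` data of Hecke characters (`GLOneOfHeckeCharacterBJ`),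
Satake families (`hasSatakeParamAt_cofinite_holds`, uniqueness `hasSatakeParamAt_unique_holds`),
(2.1) `JacquetShalika1981_multipliable_partialPairL_repData_holds`, limits as in
`exists_tendsto_pow_mul_partialPairL_ofReal_add` (`IsobaricRigidityRepData`). Size XL (the lead's stub).
[cite: JacquetShalikaAJM1981II, Prop. 3.6 and Thm. 4.4] [cite: ArthurClozelAMS120, Ch. 3 §2 (2.1)–(2.3) and Lemma 4.3] -/
theorem stub_dualityDichotomy :
    ∀ (K L : Type) [Field K] [NumberField K] [Field L] [NumberField L] [Algebra K L] [IsGalois K L],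
      Module.finrank K L = 2 → ∀ (τ : L ≃ₐ[K] L), τ ≠ 1 →
      ∀ (hcpt : isCompact_glFiniteIntegralLevel 4 K) (hL3 : isCompact_glFiniteIntegralLevel 3 L)
        (π₀ : CuspidalAutomorphicRepData 4 K hcpt) (P₀ : CuspidalAutomorphicRepData 3 L hL3),
      JacquetShalika1981_partialPairL_boundary_repData →
      JacquetShalika1981_partialPairL_pole_repData →
      (∀ᶠ v : HeightOneSpectrum (𝓞 K) in cofinite, ∀ α : Multiset ℂ, π₀.1.HasSatakeParamAt v α →
        ‖α.prod‖ = 1 ∧ ∀ a ∈ α, a ≠ 0) →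
      (∀ᶠ w : HeightOneSpectrum (𝓞 L) in cofinite, ∀ β : Multiset ℂ, P₀.1.HasSatakeParamAt w β →
        ‖β.prod‖ = 1 ∧ ∀ b ∈ β, b ≠ 0) →
      (∀ᶠ v : HeightOneSpectrum (𝓞 K) in cofinite, ∀ α : Multiset ℂ, π₀.1.HasSatakeParamAt v α →
        ((∃ w : HeightOneSpectrum (𝓞 L), w.asIdeal.under (𝓞 K) = v.asIdeal ∧
            w.asIdeal.inertiaDeg (𝓞 K) = 1) →
          ∃ w₁ w₂ : HeightOneSpectrum (𝓞 L), w₁ ≠ w₂ ∧ w₁.asIdeal.under (𝓞 K) = v.asIdeal ∧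
            w₂.asIdeal.under (𝓞 K) = v.asIdeal ∧ ∃ β₁ β₂ : Multiset ℂ,
              P₀.1.HasSatakeParamAt w₁ β₁ ∧ P₀.1.HasSatakeParamAt w₂ β₂ ∧
                (α.powersetCard 2).map Multiset.prod = β₁ + β₂) ∧
        ((¬ ∃ w : HeightOneSpectrum (𝓞 L), w.asIdeal.under (𝓞 K) = v.asIdeal ∧
            w.asIdeal.inertiaDeg (𝓞 K) = 1) →
          ∃ w : HeightOneSpectrum (𝓞 L), w.asIdeal.under (𝓞 K) = v.asIdeal ∧
            ∃ β γ : Multiset ℂ, P₀.1.HasSatakeParamAt w β ∧ γ.map (fun c => c ^ 2) = β ∧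
              (α.powersetCard 2).map Multiset.prod = γ + γ.map (fun c => -c))) →
      (∃ P' : CuspidalAutomorphicRepData 3 L hL3, ∀ᶠ w : HeightOneSpectrum (𝓞 L) in cofinite,
        ∀ β : Multiset ℂ, P'.1.HasSatakeParamAt w β ↔ P₀.1.HasSatakeParamAt (τ • w) β) →
      (∀ᶠ v : HeightOneSpectrum (𝓞 K) in cofinite, ∀ α : Multiset ℂ, π₀.1.HasSatakeParamAt v α →
          α.map (fun a => quadraticSign L v * a) = α) ∨
      (∀ᶠ w : HeightOneSpectrum (𝓞 L) in cofinite, ∀ α β : Multiset ℂ,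
        π₀.1.HasSatakeParamAt (w.under (𝓞 K)) α → P₀.1.HasSatakeParamAt w β →
          β.map (fun b => b⁻¹) = β.map (fun b => (α.prod ^ w.asIdeal.inertiaDeg (𝓞 K))⁻¹ * b)) :=
  Summit.Langlands.Langlands.Theorems.InducedSquareAscentKleinCube.stub_dualityDichotomy

/-- **STUB 7 — the Klein cube pole (Step D of the card: identity (✦) + Jacquet–Shalika).**
For unitary zero-free matching data `(π₀, P₀)`, a Galois-conjugate datum `P₀^τ`, a Hecke character
`μ` of `K` with `e₃(t_{P₀,w}) = μ(ϖ_v)^{f(w|v)}` a.e. (the descended central character of `P₀`), and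
granted Arthur–Clozel Ch. 3 (2.2), (2.3) for Borel–Jacquet data, `π₀` is essentially self-dual at
Satake level by a Hecke character: `t_{π₀,v}⁻¹ = χ(ϖ_v) t_{π₀,v}` a.e. Proof line: identity (✦) with
`c := μ⁻¹` — `L^S(π₀×π₀⊗ωμ⁻¹)·L^S(π₀^∨×π₀^∨⊗ω²μ⁻¹) = ζ_L^T · L^T(P₀^∨×P₀^τ) · L^T(P₀⊗(ωμ⁻¹)_L)²`
for real `s > 1` (`stub_localIdentities` (5)(6) with `e₃(β)c_L(ϖ_w) = 1`, regrouped along `w ↦ w ∩ 𝓞_K`); on the right `t·ζ_L^T(1+t) → c₁ ≠ 0` ((2.3), rank 1), the `GL₃×GL₃`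
factor has `t^e·L → c₂ ≠ 0` ((2.2)/(2.3)) and the `GL₃×GL₁` factor tends to `c₃ ≠ 0` ((2.2)), so
`t^{1+e}·RHS → c ≠ 0`; if neither pair on the left were in its `X`, both factors would have finite
limits ((2.2)) and `t^{1+e}·LHS → 0` — contradiction; and "in `X`" for `(π₀, π₀⊗ωμ⁻¹)` reads
`t⁻¹ = (ωμ⁻¹)(ϖ_v) t`, for `(π₀^∨, π₀^∨⊗ω²μ⁻¹)` reads `t⁻¹ = (ω⁻²μ)(ϖ_v) t`. Same data toolbox as
`stub_dualityDichotomy`. Size XL (the lead's stub).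
[cite: JacquetShalikaAJM1981II, Prop. 3.6 and Thm. 4.4] [cite: ArthurClozelAMS120, Ch. 3 §2 (2.1)–(2.3) and Lemma 4.3] -/
theorem stub_kleinCubePole :
    ∀ (K L : Type) [Field K] [NumberField K] [Field L] [NumberField L] [Algebra K L] [IsGalois K L],
      Module.finrank K L = 2 → ∀ (τ : L ≃ₐ[K] L), τ ≠ 1 →
      ∀ (hcpt : isCompact_glFiniteIntegralLevel 4 K) (hL3 : isCompact_glFiniteIntegralLevel 3 L)
        (π₀ : CuspidalAutomorphicRepData 4 K hcpt) (P₀ : CuspidalAutomorphicRepData 3 L hL3),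
      JacquetShalika1981_partialPairL_boundary_repData →
      JacquetShalika1981_partialPairL_pole_repData →
      (∀ᶠ v : HeightOneSpectrum (𝓞 K) in cofinite, ∀ α : Multiset ℂ, π₀.1.HasSatakeParamAt v α →
        ‖α.prod‖ = 1 ∧ ∀ a ∈ α, a ≠ 0) →
      (∀ᶠ w : HeightOneSpectrum (𝓞 L) in cofinite, ∀ β : Multiset ℂ, P₀.1.HasSatakeParamAt w β →
        ‖β.prod‖ = 1 ∧ ∀ b ∈ β, b ≠ 0) →
      (∀ᶠ v : HeightOneSpectrum (𝓞 K) in cofinite, ∀ α : Multiset ℂ, π₀.1.HasSatakeParamAt v α →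
        ((∃ w : HeightOneSpectrum (𝓞 L), w.asIdeal.under (𝓞 K) = v.asIdeal ∧
            w.asIdeal.inertiaDeg (𝓞 K) = 1) →
          ∃ w₁ w₂ : HeightOneSpectrum (𝓞 L), w₁ ≠ w₂ ∧ w₁.asIdeal.under (𝓞 K) = v.asIdeal ∧
            w₂.asIdeal.under (𝓞 K) = v.asIdeal ∧ ∃ β₁ β₂ : Multiset ℂ,
              P₀.1.HasSatakeParamAt w₁ β₁ ∧ P₀.1.HasSatakeParamAt w₂ β₂ ∧
                (α.powersetCard 2).map Multiset.prod = β₁ + β₂) ∧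
        ((¬ ∃ w : HeightOneSpectrum (𝓞 L), w.asIdeal.under (𝓞 K) = v.asIdeal ∧
            w.asIdeal.inertiaDeg (𝓞 K) = 1) →
          ∃ w : HeightOneSpectrum (𝓞 L), w.asIdeal.under (𝓞 K) = v.asIdeal ∧
            ∃ β γ : Multiset ℂ, P₀.1.HasSatakeParamAt w β ∧ γ.map (fun c => c ^ 2) = β ∧
              (α.powersetCard 2).map Multiset.prod = γ + γ.map (fun c => -c))) →
      (∃ P' : CuspidalAutomorphicRepData 3 L hL3, ∀ᶠ w : HeightOneSpectrum (𝓞 L) in cofinite,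
        ∀ β : Multiset ℂ, P'.1.HasSatakeParamAt w β ↔ P₀.1.HasSatakeParamAt (τ • w) β) →
      ∀ (μ : HeckeCharacter K),
      (∀ᶠ w : HeightOneSpectrum (𝓞 L) in cofinite, ∀ β : Multiset ℂ, P₀.1.HasSatakeParamAt w β →
          β.prod = μ.valueAtUniformizer (w.under (𝓞 K)) ^ w.asIdeal.inertiaDeg (𝓞 K)) →
      ∃ χ : HeckeCharacter K, ∀ᶠ v : HeightOneSpectrum (𝓞 K) in cofinite, ∀ α : Multiset ℂ,
        π₀.1.HasSatakeParamAt v α →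
          α.map (fun a => a⁻¹) = α.map (fun a => χ.valueAtUniformizer v * a) :=
  Summit.Langlands.Langlands.Theorems.InducedSquareAscentKleinCube.stub_kleinCubePole

/-! ## 2. The stub statements as named `Prop`s (literally their types) -/

namespace _Goal

/-- The statement of `stub_jacquetShalikaLeaves`, as a named `Prop` (literally its type). [folklore] -/
def stub_jacquetShalikaLeaves : Prop :=
  type_of% @Summit.Langlands.Langlands.Cruxes.InducedSquareAscent.KleinCube.stub_jacquetShalikaLeaves

/-- The statement of `stub_galConjDatum`, as a named `Prop` (literally its type). [folklore] -/
def stub_galConjDatum : Prop :=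
  type_of% @Summit.Langlands.Langlands.Cruxes.InducedSquareAscent.KleinCube.stub_galConjDatum

/-- The statement of `stub_unitaryReduction`, as a named `Prop` (literally its type). [folklore] -/
def stub_unitaryReduction : Prop :=
  type_of% @Summit.Langlands.Langlands.Cruxes.InducedSquareAscent.KleinCube.stub_unitaryReduction

/-- The statement of `stub_localIdentities`, as a named `Prop` (literally its type). [folklore] -/
def stub_localIdentities : Prop :=
  type_of% @Summit.Langlands.Langlands.Cruxes.InducedSquareAscent.KleinCube.stub_localIdentities

/-- The statement of `stub_centralCharacterDescent`, as a named `Prop` (literally its type).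
[folklore] -/
def stub_centralCharacterDescent : Prop :=
  type_of% @Summit.Langlands.Langlands.Cruxes.InducedSquareAscent.KleinCube.stub_centralCharacterDescent

/-- The statement of `stub_dualityDichotomy`, as a named `Prop` (literally its type). [folklore] -/
def stub_dualityDichotomy : Prop :=
  type_of% @Summit.Langlands.Langlands.Cruxes.InducedSquareAscent.KleinCube.stub_dualityDichotomy

/-- The statement of `stub_kleinCubePole`, as a named `Prop` (literally its type). [folklore] -/
def stub_kleinCubePole : Prop :=
  type_of% @Summit.Langlands.Langlands.Cruxes.InducedSquareAscent.KleinCube.stub_kleinCubePole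

end _Goal

/-! ## 3. The composition (kernel-checked, no `sorry`) -/

/-- A quadratic extension of number fields is Galois and has a non-trivial automorphism. [folklore] -/
theorem exists_ne_one_of_finrank_eq_two (K L : Type) [Field K] [NumberField K] [Field L]
    [NumberField L] [Algebra K L] (hdeg : Module.finrank K L = 2) :
    IsGalois K L ∧ ∃ τ : L ≃ₐ[K] L, τ ≠ 1 := by
  haveI : FiniteDimensional K L := Module.finite_of_finrank_pos (by omega)
  haveI : Algebra.IsQuadraticExtension K L := { finrank_eq_two' := hdeg }
  haveI hG : IsGalois K L := inferInstance
  refine ⟨hG, ?_⟩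
  have hcard : Fintype.card (L ≃ₐ[K] L) = 2 := by
    rw [← hdeg, ← IsGalois.card_aut_eq_finrank, Fintype.card_eq_nat_card]
  by_contra h
  push Not at h
  have : Fintype.card (L ≃ₐ[K] L) ≤ 1 := Fintype.card_le_one_iff.mpr fun a b => by rw [h a, h b]
  omega

/-- **`InducedSquareAscent` from the seven stubs and the two Jacquet–Shalika leans.** Fix
`K, π, L, P` and the matching hypothesis. `L/K` is Galois with a non-trivial `τ`
(`exists_ne_one_of_finrank_eq_two`). Reduce to unitary zero-free data `(π₀, P₀)` with the same
matching (`stub_unitaryReduction`), conjugate `P₀` by `τ` (`stub_galConjDatum`), and run the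
dichotomy (`stub_dualityDichotomy`): either `π₀` — hence `π` — is `ε_{L/K}`-self-twisted at Satake
level, which IS the crux's second disjunct with `L' := L` (`quadraticSign L v` is by definition the
crux's inline `if ∃ w ∣ v, f(w|v) = 1 then 1 else -1`); or Case I holds, the central character of `P₀`
descends (`stub_centralCharacterDescent`), the Klein cube pole (`stub_kleinCubePole`) makes `π₀`
essentially self-dual by a Hecke character, and `stub_unitaryReduction` transports this to the crux's
first disjunct for `π`. The lean `hJS` is Arthur–Clozel Ch. 3 (2.2) ∧ (2.3) for Borel–Jacquet
data (stub 0); `stub_localIdentities` is consumed inside the proofs of stubs 6–7 (listed here so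
that the skeleton records it). The conclusion is the route decl
`Summit.Langlands.Langlands.Theses.ExteriorSquareAscent.InducedSquareAscent`, by name. [folklore] -/
theorem InducedSquareAscent_of (hJS : _Goal.stub_jacquetShalikaLeaves) :
    Summit.Langlands.Langlands.Theses.ExteriorSquareAscent.InducedSquareAscent := by
  -- the stub statements, as the Π-types they literally are
  have hJS' : type_of% @stub_jacquetShalikaLeaves := hJS
  obtain ⟨h22, h23⟩ := hJS'
  -- the six other stubs are landed theorems (this file's `stub_*` are proved by them)
  have hA' : type_of% @stub_galConjDatum := stub_galConjDatum
  have hB' : type_of% @stub_unitaryReduction := stub_unitaryReduction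
  have hE' : type_of% @stub_centralCharacterDescent := stub_centralCharacterDescent
  have hF' : type_of% @stub_dualityDichotomy := stub_dualityDichotomy
  have hG' : type_of% @stub_kleinCubePole := stub_kleinCubePole
  intro K _ _ h1 hcpt π L _ _ _ hdeg hL3 P hmatch
  obtain ⟨hGal, τ, hτ⟩ := exists_ne_one_of_finrank_eq_two K L hdeg
  haveI : IsGalois K L := hGal
  -- unitary reduction
  obtain ⟨π₀, P₀, hUπ, hUP, hmatch₀, hD1, hD2⟩ := hB' K h1 hcpt π L hdeg hL3 P hmatch
  -- the Galois-conjugate datum `P₀^τ`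
  obtain ⟨P', hP'⟩ := hA' 3 K L hL3 τ P₀
  -- the dichotomy
  rcases hF' K L hdeg τ hτ hcpt hL3 π₀ P₀ h22 h23 hUπ hUP hmatch₀ ⟨P', hP'⟩ with hst | hcaseI
  · -- `π` is `ε_{L/K}`-self-twisted: the crux's second disjunct with `L' := L`
    exact Or.inr ⟨L, inferInstance, inferInstance, inferInstance, hdeg, hD2 hst⟩
  · -- Case I: descend the central character, then the Klein cube pole
    have hNZπ : ∀ᶠ v : HeightOneSpectrum (𝓞 K) in cofinite, ∀ α : Multiset ℂ,
        π₀.1.HasSatakeParamAt v α → ∀ a ∈ α, a ≠ 0 :=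
      hUπ.mono fun v hv α hα => (hv α hα).2
    have hNZP : ∀ᶠ w : HeightOneSpectrum (𝓞 L) in cofinite, ∀ β : Multiset ℂ,
        P₀.1.HasSatakeParamAt w β → ∀ b ∈ β, b ≠ 0 :=
      hUP.mono fun w hw β hβ => (hw β hβ).2
    obtain ⟨μ, hμ⟩ := hE' K L hdeg τ hτ hcpt hL3 π₀ P₀ hNZπ hNZP hmatch₀ hcaseI
    obtain ⟨χ, hχ⟩ := hG' K L hdeg τ hτ hcpt hL3 π₀ P₀ h22 h23 hUπ hUP hmatch₀ ⟨P', hP'⟩ μ hμ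
    exact Or.inl (hD1 ⟨χ, hχ⟩)

/-- By-name sanity check (an `example`, not a declaration of the file): the seven stubs and the two
leans feed the composition as they stand. -/
example : Summit.Langlands.Langlands.Theses.ExteriorSquareAscent.InducedSquareAscent :=
  InducedSquareAscent_of stub_jacquetShalikaLeaves

end Summit.Langlands.Langlands.Cruxes.InducedSquareAscent.KleinCube

end
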